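import Summits.PneNP.PneNP.Theorems.OneSliceConstantBandDefs
import Summits.PneNP.PneNP.Theorems.OneSliceShallowSliceBoundForcing

/-!
# Route OneSlice, crux `ConstantBand` (stmt-PneNP-2834): small band-accurate circuits reject bare cliques

Helper file of the line `flat-prior-relative-minterms` (lead seat c6, 2026-08-17), def-free, `--supports
stmt-PneNP-2834`. The first structural consequence of accuracy on ONE central slice for a SMALL monotone
circuit — Rossman's §7 remark at the empty background, in slice form:

* `fprm_bareCliques_forceUp` — for `k ≥ 5`, `4c < k`, `η > 0`, eventually in `n`: for every central `j`
  (`|j - m_k(n)| ≤ m_k(n)^{3/4}`) and every circuit `C` over `{∧₂, ∨₂, 0, 1}` with `≤ n^c` gates, IF `C` accepts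
  at least an `η`-fraction of the BARE `k`-cliques `K_A` (no background), THEN `C` accepts at least a
  `(1 - η)`-fraction of EVERY slice `t` with `j ≤ t ≤ C(n,2)`. Proof: Rossman's Theorem 1 at `H = ∅`
  (`thm1_finite`: `Pr[C(G(n,p⁻)) = 1] ≥ 1 - e^{-n^{c'}}`, `p⁻ = n^{-2(1+k⁻³)/(k-1)}`), the mixture bound
  `sum_ite_mul_le_sliceAvg_mul` (a monotone function accepts each slice `ℓ ≤ t` at most as often as slice `t`,
  local LYM) and Markov for the edge count of `G(n,p⁻)` (`E e(G⁻) = C(n,2)p⁻ ≤ 8 j n^{-2k⁻³/(k-1)} = o(j)` on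
  the central window).
* `fprm_bareCliques_rejected` — the contrapositive in the line's vocabulary: a `{∧₂,∨₂}`-circuit of size
  `≤ n^c` that accepts at most HALF of one central slice `j` (every band-accurate circuit does: the clique
  density of a central slice is `≤ 1/3` eventually, `ts_eventually_window`) accepts fewer than an `η`-fraction
  of the bare `k`-cliques, for every `η > 0` eventually. Consequence for the line (informal): under a typical
  accepted YES instance `x ∪ K_A` of the band, no minterm of `C` is a subgraph of the planted clique alone —
  every accepting certificate uses background edges (the relative analysis of S3/S4 starts here).

[cite: Rossman2010, Thm 1 (p. 4) and §7 (p. 10)]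
-/

set_option linter.dupNamespace false

noncomputable section

namespace Summit.PneNP.PneNP.Cruxes.ConstantBand.FlatPriorRelativeMinterms

open Finset Filter Literature.Computability.Complexity Classical
open Summit.PneNP.PneNP.Cruxes.SliceACZero.RussoWindowLadder (wt sliceAvg)
open Summit.PneNP.PneNP.Theorems.ShallowSliceBound
open scoped Topology

/-- **Markov for the edge count of `G(n,p)`**: `(t + 1) · Pr[e(G(n,p)) > t] ≤ C(n,2) p` for `0 ≤ p ≤ 1`.
[folklore] -/
theorem fprm_gnp_edgeCount_tail {n : ℕ} {p : ℝ} (hp0 : 0 ≤ p) (hp1 : p ≤ 1) (t : ℕ) :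
    ((t : ℝ) + 1) * ∑ y ∈ univ.filter (fun y : Edge n → Bool => t < edgeCount y), gnpWeight n p y ≤
      n.choose 2 * p := by
  have hw := fun y : Edge n → Bool => gnpWeight_nonneg hp0 hp1 y
  calc ((t : ℝ) + 1) * ∑ y ∈ univ.filter (fun y : Edge n → Bool => t < edgeCount y), gnpWeight n p y
      = ∑ y ∈ univ.filter (fun y : Edge n → Bool => t < edgeCount y), ((t : ℝ) + 1) * gnpWeight n p y := by
        rw [mul_sum]
    _ ≤ ∑ y ∈ univ.filter (fun y : Edge n → Bool => t < edgeCount y), gnpWeight n p y * edgeCount y := by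
        refine sum_le_sum fun y hy => ?_
        rw [mem_filter] at hy
        have h1 : (t : ℝ) + 1 ≤ edgeCount y := by exact_mod_cast hy.2
        rw [mul_comm]
        exact mul_le_mul_of_nonneg_left h1 (hw y)
    _ ≤ ∑ y : Edge n → Bool, gnpWeight n p y * edgeCount y :=
        sum_le_sum_of_subset_of_nonneg (filter_subset _ _) fun y _ _ => mul_nonneg (hw y) (Nat.cast_nonneg _)
    _ = n.choose 2 * p := sum_gnpWeight_mul_edgeCount p

/-- **From `G(n,p)`-acceptance to slice acceptance** (monotone `f`): for `t ≤ C(n,2)` and `0 ≤ p ≤ 1`,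
`Pr[f(G(n,p)) = 1] ≤ a_t(f) + C(n,2) p / (t + 1)` — split at `e(G) ≤ t` (a mixture of the slices `≤ t`, each
accepted at most as often as slice `t`) and `e(G) > t` (Markov). [folklore] -/
theorem fprm_gnp_accept_le_sliceAvg_add {n : ℕ} {f : (Edge n → Bool) → Bool} (hf : Monotone f) {p : ℝ}
    (hp0 : 0 ≤ p) (hp1 : p ≤ 1) {t : ℕ} (ht : t ≤ n.choose 2) :
    ∑ y : Edge n → Bool, gnpWeight n p y * (if f y = true then (1 : ℝ) else 0) ≤
      sliceAvg f t + n.choose 2 * p / ((t : ℝ) + 1) := by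
  have hw := fun y : Edge n → Bool => gnpWeight_nonneg hp0 hp1 y
  -- split the indicator at `e(y) ≤ t`
  have hsplit : ∀ y : Edge n → Bool, gnpWeight n p y * (if f y = true then (1 : ℝ) else 0) =
      (if f y = true ∧ edgeCount y ≤ t then (1 : ℝ) else 0) * gnpWeight n p y +
      gnpWeight n p y * (if t < edgeCount y then (if f y = true then (1 : ℝ) else 0) else 0) := by
    intro y
    by_cases h1 : f y = true
    · by_cases h2 : edgeCount y ≤ t
      · simp [h1, h2]
      · simp [h1, h2, not_le.1 h2]
    · simp [h1]
  simp_rw [hsplit, sum_add_distrib]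
  refine add_le_add ?_ ?_
  · -- the mixture of the slices `≤ t`
    have hmix := sum_ite_mul_le_sliceAvg_mul hf ht (fun ℓ => p ^ ℓ * (1 - p) ^ (n.choose 2 - ℓ))
      (fun ℓ => by have : 0 ≤ 1 - p := by linarith
                   positivity)
    have hmass : ∑ z : Edge n → Bool, p ^ edgeCount z * (1 - p) ^ (n.choose 2 - edgeCount z) = 1 :=
      sum_gnpWeight p
    rw [hmass, mul_one] at hmix
    exact hmix
  · -- the tail `e(y) > t`: Markov
    have htail := fprm_gnp_edgeCount_tail hp0 hp1 t (n := n)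
    have hden : (0 : ℝ) < (t : ℝ) + 1 := by positivity
    rw [le_div_iff₀ hden, mul_comm]
    refine le_trans ?_ htail
    refine mul_le_mul_of_nonneg_left ?_ hden.le
    rw [sum_filter]
    refine sum_le_sum fun y _ => ?_
    by_cases h : t < edgeCount y
    · rw [if_pos h, if_pos h]
      by_cases h' : f y = true <;> simp [h', hw y]
    · rw [if_neg h, if_neg h]
      simp

/-- **Bare cliques force acceptance of every higher slice** (Rossman 2010, Theorem 1 at the empty background,
slice form). For `k ≥ 5`, `4c < k` and `η > 0`, eventually in `n`: for every central `j` and every circuit `C`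
over `{∧₂, ∨₂, 0, 1}` with `≤ n^c` gates accepting at least an `η`-fraction of the bare `k`-cliques `K_A`,
`a_t(C) ≥ 1 - η` for EVERY slice `t` with `j ≤ t ≤ C(n,2)`. [cite: Rossman2010, Thm 1 (p. 4), §7 (p. 10)] -/
theorem fprm_bareCliques_forceUp :
    ∀ k : ℕ, 5 ≤ k → ∀ c : ℕ, 4 * c < k → ∀ η : ℝ, 0 < η →
      ∀ᶠ n : ℕ in atTop, ∀ j : ℕ, Central k n j →
        ∀ C : Circuit (Edge n), C.IsOver monotoneBasis01 → C.size ≤ n ^ c →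
          η ≤ kSubsetProb n k (fun A => C.eval (cliqueVec A) = true) →
          ∀ t : ℕ, j ≤ t → t ≤ n.choose 2 → 1 - η ≤ sliceAvg C.eval t := by
  intro k hk c hc η hη
  have hk2 : 2 ≤ k := by omega
  have hk3 : 3 ≤ k := by omega
  -- constants
  obtain ⟨δ₁, hδ₁⟩ : ∃ d : ℝ, d = 1 / (k : ℝ) ^ 3 := ⟨_, rfl⟩
  have hδ₁0 : 0 < δ₁ := by rw [hδ₁]; positivity
  have hδ₁1 : δ₁ ≤ 1 / (k : ℝ) ^ 3 := hδ₁.le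
  have hk1 : (0 : ℝ) < (k : ℝ) - 1 := by
    have : (5 : ℝ) ≤ k := by exact_mod_cast hk
    linarith
  have hcp := cPrime_pos hk hδ₁0 hδ₁1
  have hexpδ : 0 < 2 * δ₁ / ((k : ℝ) - 1) := div_pos (by linarith) hk1
  -- the largeness conditions
  have E6 : ∀ᶠ n : ℕ in atTop, ((n ^ c : ℕ) : ℝ) ≤ 1 * (n : ℝ) ^ ((k : ℝ) / 4) := by
    filter_upwards [eventually_ge_atTop 1] with n hn
    have hn1 : (1 : ℝ) ≤ n := by exact_mod_cast hn
    have hck : (c : ℝ) ≤ (k : ℝ) / 4 := by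
      have : ((4 * c : ℕ) : ℝ) < k := by exact_mod_cast hc
      push_cast at this; linarith
    have h1 : (n : ℝ) ^ (c : ℝ) ≤ (n : ℝ) ^ ((k : ℝ) / 4) := Real.rpow_le_rpow_of_exponent_le hn1 hck
    rw [Real.rpow_natCast] at h1
    push_cast; linarith
  filter_upwards [eventually_largeN hk hδ₁0 hδ₁1 1 η hη, forcing_window hk3,
    eventually_exp_neg_rpow_le hcp (by positivity : (0 : ℝ) < η / 4),
    eventually_mul_rpow_neg_lt hexpδ (by positivity : (0 : ℝ) < η / 4) 8, E6, eventually_ge_atTop 1]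
    with n hL hW hE4 hE5 hE6 hn1 j hj C hC hsize hacc t hjt htN
  obtain ⟨hNpos, _, hWj⟩ := hW
  obtain ⟨hjK2, _, _, hTj⟩ := hWj j hj
  set N := n.choose 2 with hN
  set r : ℝ := (n : ℝ) ^ (-(2 : ℝ) / ((k : ℝ) - 1)) with hrdef
  have hnR : (1 : ℝ) ≤ n := by exact_mod_cast hn1
  have hn0 : (0 : ℝ) < n := by linarith
  have hjpos : (0 : ℝ) < j := by
    have : (1 : ℝ) ≤ j := by
      have : 1 ≤ j := by omega
      exact_mod_cast this
    linarith
  set p : ℝ := pMinus k δ₁ n with hpdef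
  have hp0 : 0 < p := Real.rpow_pos_of_pos hn0 _
  have hp1 : p ≤ 1 := by have := hL.hp; linarith
  -- Theorem 1 at the empty background
  have hsizeR : (C.size : ℝ) ≤ 1 * (n : ℝ) ^ ((k : ℝ) / 4) := by
    have : (C.size : ℝ) ≤ ((n ^ c : ℕ) : ℝ) := by exact_mod_cast hsize
    exact this.trans hE6
  have h1 := thm1_finite hk hδ₁0 hδ₁1 hη hL C hC hsizeR hacc
  rw [← hpdef, gnpProb_filter] at h1
  have h1' : 1 - Real.exp (-((n : ℝ) ^ cPrime k δ₁)) ≤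
      ∑ y : Edge n → Bool, gnpWeight n p y * (if C.eval y = true then (1 : ℝ) else 0) := by
    refine h1.trans (le_of_eq (sum_congr rfl fun y _ => ?_))
    by_cases hy : C.eval y = true <;> simp [hy]
  -- the slice transfer
  have hmono : Monotone C.eval := C.monotone_eval_of_isOver_monotoneBasis01 hC
  have h2 := fprm_gnp_accept_le_sliceAvg_add hmono hp0.le hp1 htN (n := n)
  -- the tail is small: `N p ≤ 8 j n^{-2δ₁/(k-1)}` and `t + 1 ≥ j`
  have htail : (N : ℝ) * p / ((t : ℝ) + 1) ≤ η / 4 := by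
    have hNp : (N : ℝ) * p ≤ 8 * j * (n : ℝ) ^ (-(2 * δ₁ / ((k : ℝ) - 1))) := by
      have hsplit : p = r * (n : ℝ) ^ (-(2 * δ₁ / ((k : ℝ) - 1))) := by
        rw [hpdef, pMinus, hrdef, ← Real.rpow_add hn0]; congr 1; ring
      rw [hsplit, ← mul_assoc]
      refine mul_le_mul_of_nonneg_right ?_ (Real.rpow_nonneg hn0.le _)
      have hK0 : (0 : ℝ) ≤ ((k.choose 2 : ℕ) : ℝ) := Nat.cast_nonneg _
      have : ((n.choose 2 : ℕ) : ℝ) * (n : ℝ) ^ (-(2 : ℝ) / ((k : ℝ) - 1)) = (N : ℝ) * r := by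
        rw [hN, hrdef]
      linarith
    have hden : (0 : ℝ) < (t : ℝ) + 1 := by positivity
    have hjt1 : (j : ℝ) ≤ (t : ℝ) + 1 := by
      have : (j : ℝ) ≤ t := by exact_mod_cast hjt
      linarith
    calc (N : ℝ) * p / ((t : ℝ) + 1) ≤ (8 * j * (n : ℝ) ^ (-(2 * δ₁ / ((k : ℝ) - 1)))) / (j : ℝ) :=
          div_le_div₀ (by positivity) hNp hjpos hjt1
      _ = 8 * (n : ℝ) ^ (-(2 * δ₁ / ((k : ℝ) - 1))) := by
          field_simp
      _ ≤ η / 4 := hE5.le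
  have he4 : Real.exp (-((n : ℝ) ^ cPrime k δ₁)) ≤ η / 4 := hE4
  linarith

/-- The slice average of `OneSliceSliceACZeroDefs` is the slice fraction of the line's vocabulary. [folklore] -/
theorem fprm_sliceAvg_eq_sliceProb {n : ℕ} (f : (Edge n → Bool) → Bool) (i : ℕ) :
    sliceAvg f i = sliceProb n i (fun x => f x = true) := by
  rw [sliceAvg, sliceProb, slice_eq_filter_wt, filter_filter]
  -- the two sides differ only in the `DecidablePred` instances of the filters
  convert rfl

/-- **Small circuits that accept at most half a central slice reject bare cliques** (contrapositive of
`fprm_bareCliques_forceUp`, in the line's vocabulary). For `k ≥ 5`, `4c < k` and `η > 0`, eventually in `n`: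
for every central `j` and every `{∧₂, ∨₂}`-circuit `C` of size `≤ n^c` with `P_{x ∼ G(n,j)}[C(x) = 1] ≤ 1/2`
(as every band-accurate circuit has, the clique density of a central slice being `≤ 1/3`), the fraction of bare
`k`-cliques `K_A` accepted by `C` is `< η`. Hence the accepting certificates (minterms) of a small band-accurate
circuit below a typical YES instance `x ∪ K_A` are never subgraphs of the planted clique alone.
[cite: Rossman2010, Thm 1 (p. 4), §7 (p. 10)] -/
theorem fprm_bareCliques_rejected :
    ∀ k : ℕ, 5 ≤ k → ∀ c : ℕ, 4 * c < k → ∀ η : ℝ, 0 < η →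
      ∀ᶠ n : ℕ in atTop, ∀ j : ℕ, Central k n j →
        ∀ C : Circuit (Edge n), C.IsOver monotoneBasis → C.size ≤ n ^ c →
          sliceProb n j (fun x => C.eval x = true) ≤ 1 / 2 →
          kSubsetProb n k (fun A => C.eval (cliqueVec A) = true) < η := by
  intro k hk c hc η hη
  have hη' : 0 < min η (1 / 4) := lt_min hη (by norm_num)
  filter_upwards [fprm_bareCliques_forceUp k hk c hc (min η (1 / 4)) hη', forcing_window (k := k) (by omega)]
    with n hn hW j hj C hC hsize hhalf
  obtain ⟨_, _, hWj⟩ := hW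
  obtain ⟨_, h4j, _, _⟩ := hWj j hj
  by_contra hacc
  rw [not_lt] at hacc
  have hjN : j ≤ n.choose 2 := by omega
  have h := hn j hj C (hC.mono monotoneBasis_subset_monotoneBasis01) hsize ((min_le_left _ _).trans hacc) j
    le_rfl hjN
  rw [fprm_sliceAvg_eq_sliceProb] at h
  have : min η (1 / 4) ≤ 1 / 4 := min_le_right _ _
  linarith

end Summit.PneNP.PneNP.Cruxes.ConstantBand.FlatPriorRelativeMinterms

end
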